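import Mathlib
import Literature.RingTheory.MvPolynomial.PrincipalIdealRadicalFormula

/-!
# Irreducible factors and iterated derivatives in characteristic zero

Let `K` be a field of characteristic zero, `R : K[X]` irreducible and `G : K[X]` arbitrary.  Then

  `R ^ t ∣ G ↔ ∀ j < t, R ∣ derivative^[j] G`

(`soloID_pow_dvd_iff_dvd_iterate_derivative`), and consequently for a *squarefree* `F`:
`(∀ j < t, F ∣ derivative^[j] G) → F ^ t ∣ G`, so `t * natDegree F ≤ natDegree G` when `G ≠ 0`
(`soloID_squarefree_pow_dvd_of_dvd_iterate_derivative`, `soloID_mul_natDegree_le`).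

The direction `←` generalises Mathlib's linear-factor statement
`Polynomial.lt_rootMultiplicity_of_isRoot_iterate_derivative` (the case `R = X - C a`) to an
arbitrary irreducible factor; `→` is Mathlib's `Polynomial.pow_sub_dvd_iterate_derivative_of_pow_dvd`.
The first-derivative step — `R ^ (n+1) ∤ (R ^ (n+1) * h)'` when `R ∤ h` (characteristic zero) — is
the tree's `Literature.RingTheory.MvPolynomial.PrincipalIdealRadicalFormula.not_pow_succ_dvd_derivative`
[cite: CoxLittleOShea2007, Ch.1 §5 Ex. 14(a)], used here as is; this file only iterates it to
higher derivatives (induction on `t`, applying the induction hypothesis to `G` and to `G'`) and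
assembles squarefree divisors prime by prime (`WfDvdMonoid.induction_on_irreducible`, coprimality
of distinct irreducible factors).

Role (toy layer of this seat's Schanuel notes; no novelty is claimed — the mechanism is the
"radical of the gcd of the derivatives" step in D. Roy, *Small value estimates for the additive
group*, Int. J. Number Theory 6 (2010), arXiv:0708.2307, sketch of Thm 1.1 (3) on p. 4 and
Lemma 4.3 [cite: Roy2010, §1 p. 4 step 3); Lemma 4.3]): if a squarefree `F` divides `G^{(j)}` for
all `G` in a family and all `j < t`, then `F ^ t` divides the gcd of the family, whence
`deg F ≤ (deg gcd) / t` (`soloID_squarefree_pow_dvd_sum`, `soloID_mul_natDegree_le`).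
-/

namespace Summit.Schanuel.Schanuel.Theorems

open Polynomial
open Literature.RingTheory.MvPolynomial.PrincipalIdealRadicalFormula (not_pow_succ_dvd_derivative)

variable {K : Type*} [Field K]

/-- Key step: for `R` irreducible in characteristic zero and `m ≠ 0`, if `R ^ m ∣ G` and
`R ^ m ∣ derivative G` then `R ^ (m + 1) ∣ G` (from the tree's `not_pow_succ_dvd_derivative`). -/
theorem soloID_pow_succ_dvd [CharZero K] {R G : K[X]} (hR : Irreducible R) {m : ℕ}
    (hm : m ≠ 0) (hG : R ^ m ∣ G) (hG' : R ^ m ∣ derivative G) : R ^ (m + 1) ∣ G := by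
  obtain ⟨H, rfl⟩ := hG
  obtain ⟨k, rfl⟩ := Nat.exists_eq_succ_of_ne_zero hm
  by_cases hRH : R ∣ H
  · obtain ⟨H', rfl⟩ := hRH
    exact ⟨H', by ring⟩
  · exact absurd hG' (not_pow_succ_dvd_derivative hR hRH k)

/-- **(R3)** For `R` irreducible over a field of characteristic zero: if `R` divides the iterated
derivatives `derivative^[j] G` for all `j < t`, then `R ^ t ∣ G`.  (Generalises
`Polynomial.lt_rootMultiplicity_of_isRoot_iterate_derivative` from `X - C a` to any irreducible
factor.) -/
theorem soloID_pow_dvd_of_dvd_iterate_derivative [CharZero K] {R : K[X]} (hR : Irreducible R)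
    (t : ℕ) (G : K[X]) (hG : ∀ j < t, R ∣ derivative^[j] G) : R ^ t ∣ G := by
  induction t generalizing G with
  | zero => simp
  | succ t ih =>
    rcases Nat.eq_zero_or_pos t with ht | ht
    · subst ht
      simpa using hG 0 Nat.zero_lt_one
    · have h1 : R ^ t ∣ G := ih G (fun j hj => hG j (Nat.lt_succ_of_lt hj))
      have h2 : R ^ t ∣ derivative G := ih (derivative G) (fun j hj => by
        have := hG (j + 1) (Nat.succ_lt_succ hj)
        simpa only [Function.iterate_succ_apply] using this)
      exact soloID_pow_succ_dvd hR ht.ne' h1 h2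

/-- The easy converse (Mathlib's `pow_sub_dvd_iterate_derivative_of_pow_dvd`): `R ^ t ∣ G`
implies `R ∣ derivative^[j] G` for every `j < t`. -/
theorem soloID_dvd_iterate_derivative_of_pow_dvd {R G : K[X]} {t : ℕ} (h : R ^ t ∣ G)
    {j : ℕ} (hj : j < t) : R ∣ derivative^[j] G :=
  (dvd_pow_self R (Nat.sub_ne_zero_of_lt hj)).trans (pow_sub_dvd_iterate_derivative_of_pow_dvd j h)

/-- **(R3), iff form.** For `R` irreducible over a field of characteristic zero,
`R ^ t ∣ G ↔ ∀ j < t, R ∣ derivative^[j] G`. -/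
theorem soloID_pow_dvd_iff_dvd_iterate_derivative [CharZero K] {R : K[X]} (hR : Irreducible R)
    (t : ℕ) (G : K[X]) : R ^ t ∣ G ↔ ∀ j < t, R ∣ derivative^[j] G :=
  ⟨fun h _ hj => soloID_dvd_iterate_derivative_of_pow_dvd h hj,
    soloID_pow_dvd_of_dvd_iterate_derivative hR t G⟩

/-- Squarefree assembly (any field): if `F` is squarefree and `p ^ t ∣ G` for every irreducible
`p ∣ F`, then `F ^ t ∣ G`. -/
theorem soloID_squarefree_pow_dvd {F G : K[X]} (hF : Squarefree F) (t : ℕ)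
    (h : ∀ p : K[X], Irreducible p → p ∣ F → p ^ t ∣ G) : F ^ t ∣ G := by
  induction F using WfDvdMonoid.induction_on_irreducible generalizing G with
  | zero => exact absurd hF not_squarefree_zero
  | unit u hu => exact (hu.pow t).dvd
  | mul a i ha hi ih =>
    have hia : ¬ i ∣ a := by
      intro hd
      have : i * i ∣ i * a := mul_dvd_mul_left i hd
      exact hi.not_isUnit (hF i this)
    have hcop : IsCoprime i a := hi.coprime_iff_not_dvd.mpr hia
    have hsa : Squarefree a := hF.of_mul_right
    have h1 : i ^ t ∣ G := h i hi (dvd_mul_right i a)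
    have h2 : a ^ t ∣ G :=
      ih hsa (fun p hp hpa => h p hp (hpa.trans (dvd_mul_left a i)))
    rw [mul_pow]
    exact (hcop.pow).mul_dvd h1 h2

/-- **(R3) for a squarefree divisor.** Over a field of characteristic zero: if `F` is squarefree
and `F ∣ derivative^[j] G` for all `j < t`, then `F ^ t ∣ G`. -/
theorem soloID_squarefree_pow_dvd_of_dvd_iterate_derivative [CharZero K] {F G : K[X]}
    (hF : Squarefree F) (t : ℕ) (hG : ∀ j < t, F ∣ derivative^[j] G) : F ^ t ∣ G :=
  soloID_squarefree_pow_dvd hF t (fun _ hp hpF =>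
    soloID_pow_dvd_of_dvd_iterate_derivative hp t G (fun j hj => hpF.trans (hG j hj)))

/-- Degree consequence: under the hypotheses of
`soloID_squarefree_pow_dvd_of_dvd_iterate_derivative` and `G ≠ 0`,
`t * natDegree F ≤ natDegree G` (so `deg F ≤ deg G / t`). -/
theorem soloID_mul_natDegree_le [CharZero K] {F G : K[X]} (hF : Squarefree F) (t : ℕ)
    (hG : ∀ j < t, F ∣ derivative^[j] G) (hG0 : G ≠ 0) :
    t * F.natDegree ≤ G.natDegree := by
  have h := natDegree_le_of_dvd (soloID_squarefree_pow_dvd_of_dvd_iterate_derivative hF t hG) hG0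
  rwa [natDegree_pow] at h

/-- The same for a finite family sharing the squarefree divisor: if `F ∣ derivative^[j] (G i)` for
all `i ∈ s` and `j < t`, then `F ^ t` divides every `K[X]`-linear combination `∑ i ∈ s, c i * G i`
— in particular any gcd of the family written as such a combination. -/
theorem soloID_squarefree_pow_dvd_sum [CharZero K] {ι : Type*} (s : Finset ι) {F : K[X]}
    (hF : Squarefree F) (t : ℕ) (G c : ι → K[X])
    (hG : ∀ i ∈ s, ∀ j < t, F ∣ derivative^[j] (G i)) :
    F ^ t ∣ ∑ i ∈ s, c i * G i :=
  Finset.dvd_sum fun i hi =>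
    (soloID_squarefree_pow_dvd_of_dvd_iterate_derivative hF t (hG i hi)).mul_left (c i)

end Summit.Schanuel.Schanuel.Theorems
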